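import Summits.QuantumAdvantage.AdviceFreeQNC0.PLDAMSAllDensities
import Summits.QuantumAdvantage.AdviceFreeQNC0.ProductGame
import Summits.QuantumAdvantage.AdviceFreeQNC0.JointResidueElimination
import HarnessLib

/-!
# Cell qa-qnc0 (rung F-Q1, route RingFrame, crux α, line `product`): the load-bearing stub
# `LDMAPolylog` holds for SEPARABLE (partition-measurable) maps

The open stub of line `product` is `LDMAPolylog` (TARGET §17.4): for a map `Γ` with columns of
degree `≤ D`, every residue class `|u| ≡ r (3)` carries a `κ`-fraction of `Σ_u dist(Γ u, 𝓕_D)`.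
With qn-lit's `pldams_allDensities` (PLDAMS at every density, `d ≤ c√n`, p437365) the SEPARABLE
case of TARGET §17.2 is now unconditional: if `Γ u = G(π u)` factors through a partition
`π : {0,1}^L → Fin t` whose parts are supports of polynomials of degree `≤ (log₂ L)^C`, then for
EVERY weight `φ : Fin t → ℕ` (in particular `φ s = distFail D (G s)`)

  `κ · Σ_u φ(π u) ≤ Σ_{|u| ≡ r} φ(π u)`,

with the absolute `κ` of `pldams_allDensities`, uniformly in the number of parts `t`
(`separable_weighted_avoidance`; the `LDMAPolylog`-shaped corollary `ldmaPolylog_separable`).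
Proof: regroup by parts and apply PLDAMS to each part.  So the non-separable ("general Alice")
case is exactly what remains of `stub_LDMA`.

The cell's statements (prover; TARGET §17.2 Cor. (b) made unconditional); not in print.
WHAT THIS IS NOT: not `LDMAPolylog` (general column-low-degree `Γ`); nothing on α; no separation.
-/

noncomputable section

namespace Summit.QuantumAdvantage.AdviceFreeQNC0

open Finset
open Literature.Computability.MetaComplexity Literature.Computability.MetaComplexity.Smolensky

variable {L : ℕ}

/-- **Weighted residue avoidance for partition-measurable weights.**  There is an absolute
`κ > 0` such that for every `C`, all large `L`, every partition label `π : {0,1}^L → Fin t` whose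
parts `{π = s}` are supports of `𝔽₂`-polynomials of degree `≤ (log₂ L)^C`, every weight
`φ : Fin t → ℕ` and every residue `r`: `κ · Σ_u φ(π u) ≤ Σ_{|u| ≡ r (3)} φ(π u)`.
(Cell statement, TARGET §17.2 (b); from `pldams_allDensities` part by part.)
[cite: Srinivasan2023, Lemma 3.1] -/
theorem separable_weighted_avoidance :
    ∃ κ : ℝ, 0 < κ ∧ ∀ C : ℕ, ∃ L₀ : ℕ, ∀ L : ℕ, L₀ ≤ L → ∀ t : ℕ, ∀ π : (Fin L → Bool) → Fin t,
      (∀ s : Fin t, ∃ g : CubeFn (ZMod 2) L, g ∈ lowDeg (ZMod 2) L ((Nat.log 2 L) ^ C) ∧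
        ∀ u, g u ≠ 0 ↔ π u = s) →
      ∀ φ : Fin t → ℕ, ∀ r : ℕ,
        κ * ((∑ u : Fin L → Bool, φ (π u) : ℕ) : ℝ) ≤
          ((∑ u ∈ univ.filter (fun u : Fin L → Bool => wt u % 3 = r % 3), φ (π u) : ℕ) : ℝ) := by
  classical
  obtain ⟨κ, hκ, c, hc, n₀, hP⟩ := pldams_allDensities
  refine ⟨κ, hκ, fun C => ?_⟩
  obtain ⟨n₁, hn₁⟩ := logPow_le_sqrt' C hc
  refine ⟨max n₀ n₁, fun L hL t π hπ φ r => ?_⟩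
  have hLn₀ : n₀ ≤ L := le_trans (le_max_left _ _) hL
  have hdeg : (((Nat.log 2 L) ^ C : ℕ) : ℝ) ≤ c * Real.sqrt L := hn₁ L (le_trans (le_max_right _ _) hL)
  -- regroup both sums by parts
  have hall : (∑ u : Fin L → Bool, φ (π u)) =
      ∑ s : Fin t, φ s * (univ.filter fun u : Fin L → Bool => π u = s).card := by
    rw [← Finset.sum_fiberwise_of_maps_to (s := (univ : Finset (Fin L → Bool)))
      (t := (univ : Finset (Fin t))) (g := π) (fun u _ => mem_univ _) (f := fun u => φ (π u))]
    refine Finset.sum_congr rfl fun s _ => ?_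
    rw [Finset.sum_congr rfl (fun u hu => by rw [(Finset.mem_filter.1 hu).2]), Finset.sum_const,
      smul_eq_mul, Nat.mul_comm]
  have hcls : (∑ u ∈ univ.filter (fun u : Fin L → Bool => wt u % 3 = r % 3), φ (π u)) =
      ∑ s : Fin t, φ s * (univ.filter fun u : Fin L → Bool => π u = s ∧ wt u % 3 = r % 3).card := by
    rw [← Finset.sum_fiberwise_of_maps_to (s := univ.filter (fun u : Fin L → Bool => wt u % 3 = r % 3))
      (t := (univ : Finset (Fin t))) (g := π) (fun u _ => mem_univ _) (f := fun u => φ (π u))]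
    refine Finset.sum_congr rfl fun s _ => ?_
    rw [Finset.sum_congr rfl (fun u hu => by rw [(Finset.mem_filter.1 hu).2]), Finset.sum_const,
      smul_eq_mul, Nat.mul_comm, Finset.filter_filter]
    congr 2
    exact Finset.filter_congr fun u _ => and_comm
  rw [hall, hcls]
  push_cast
  rw [Finset.mul_sum]
  refine Finset.sum_le_sum fun s _ => ?_
  -- PLDAMS on the part `{π = s}`
  obtain ⟨g, hg, hgs⟩ := hπ s
  have h := hP L hLn₀ r ((Nat.log 2 L) ^ C) hdeg g hg
  have hset1 : (univ.filter fun u : Fin L → Bool => g u ≠ 0) =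
      univ.filter fun u : Fin L → Bool => π u = s := filter_congr fun u _ => hgs u
  have hset2 : (univ.filter fun u : Fin L → Bool => g u ≠ 0 ∧ Hegedus.wt u % 3 = r % 3) =
      univ.filter fun u : Fin L → Bool => π u = s ∧ wt u % 3 = r % 3 :=
    filter_congr fun u _ => by rw [hgs u]; exact Iff.rfl
  have h' : κ * ((univ.filter fun u : Fin L → Bool => π u = s).card : ℝ) ≤
      ((univ.filter fun u : Fin L → Bool => π u = s ∧ wt u % 3 = r % 3).card : ℝ) := by
    rw [← hset1, ← hset2]; exact h
  have hφ : (0 : ℝ) ≤ (φ s : ℝ) := Nat.cast_nonneg _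
  calc κ * ((φ s : ℝ) * ((univ.filter fun u : Fin L → Bool => π u = s).card : ℝ))
      = (φ s : ℝ) * (κ * ((univ.filter fun u : Fin L → Bool => π u = s).card : ℝ)) := by ring
    _ ≤ (φ s : ℝ) * ((univ.filter fun u : Fin L → Bool => π u = s ∧ wt u % 3 = r % 3).card : ℝ) :=
        mul_le_mul_of_nonneg_left h' hφ

/-- **`LDMAPolylog` on separable maps** (the stub's shape, restricted): there is `κ > 0` such that
for every `C`, all large `L, L'`, every `D`, every map `Γ : {0,1}^L → ({0,1}^{L'} → Bool)` that
factors as `Γ u = G (π u)` through a partition `π` into supports of degree-`≤ (log₂ min(L,L'))^C`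
polynomials, and every `r`: `κ · Σ_u distFail D (Γ u) ≤ Σ_{|u| ≡ r} distFail D (Γ u)`.
(Cell statement: the separable case of TARGET §17.4 `LDMA`, unconditional via PLDAMS.)
[cite: Srinivasan2023, Lemma 3.1] -/
theorem ldmaPolylog_separable :
    ∃ κ : ℝ, 0 < κ ∧ ∀ C : ℕ, ∃ L₀ : ℕ, ∀ L L' : ℕ, L₀ ≤ L → L₀ ≤ L' → ∀ D : ℕ,
      ∀ Γ : (Fin L → Bool) → (Fin L' → Bool) → Bool,
      (∃ t : ℕ, ∃ π : (Fin L → Bool) → Fin t, ∃ G : Fin t → (Fin L' → Bool) → Bool,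
        (∀ s : Fin t, ∃ g : CubeFn (ZMod 2) L, g ∈ lowDeg (ZMod 2) L ((Nat.log 2 (min L L')) ^ C) ∧
          ∀ u, g u ≠ 0 ↔ π u = s) ∧ ∀ u, Γ u = G (π u)) →
      ∀ r : ℕ,
        κ * ((∑ u : Fin L → Bool, distFail D (Γ u) : ℕ) : ℝ) ≤
          ((∑ u ∈ univ.filter (fun u : Fin L → Bool => wt u % 3 = r % 3), distFail D (Γ u) : ℕ) : ℝ) := by
  obtain ⟨κ, hκ, hS⟩ := separable_weighted_avoidance
  refine ⟨κ, hκ, fun C => ?_⟩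
  obtain ⟨L₀, hL₀⟩ := hS C
  refine ⟨L₀, fun L L' hL _ D Γ hΓ r => ?_⟩
  obtain ⟨t, π, G, hπ, hΓG⟩ := hΓ
  have hπ' : ∀ s : Fin t, ∃ g : CubeFn (ZMod 2) L, g ∈ lowDeg (ZMod 2) L ((Nat.log 2 L) ^ C) ∧
      ∀ u, g u ≠ 0 ↔ π u = s := by
    intro s
    obtain ⟨g, hg, hgs⟩ := hπ s
    exact ⟨g, lowDeg_mono (Nat.pow_le_pow_left (Nat.log_mono_right (min_le_left _ _)) C) hg, hgs⟩
  have h := hL₀ L hL t π hπ' (fun s => distFail D (G s)) r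
  have h1 : (∑ u : Fin L → Bool, distFail D (Γ u)) = ∑ u : Fin L → Bool, distFail D (G (π u)) :=
    Finset.sum_congr rfl fun u _ => by rw [hΓG u]
  have h2 : (∑ u ∈ univ.filter (fun u : Fin L → Bool => wt u % 3 = r % 3), distFail D (Γ u)) =
      ∑ u ∈ univ.filter (fun u : Fin L → Bool => wt u % 3 = r % 3), distFail D (G (π u)) :=
    Finset.sum_congr rfl fun u _ => by rw [hΓG u]
  rw [h1, h2]
  exact h

end Summit.QuantumAdvantage.AdviceFreeQNC0
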